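import Summits.HodgeConjecture.HodgeConjecture.Theorems.SiegelClassifyEqOfAdmissible
import Literature.AlgebraicGeometry.ModuliOfAbelianVarieties.SiegelHeckeQuotientPeriodCompatible
import HarnessLib

/-!
# The pointwise Hecke quotient has the class the link prescribes: `Φ(s′) = x` (Hecke-link line, socket (B), the `Φ s′ = x` clause)

Cell hodgecm-mathlib (D-0151), crux `hDel` / E-road line `EquidimOfF`, Hecke-link sub-line (card v1.1), socket (B) «isogeny-quotient
map» (B-p14 (g14)).  THEOREMS ONLY; no definition, no named fact, no instance, no `sorry`.  HC_CM is proved only modulo the printed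
citations until rung 0 closes.

The socket `SocketQuotientMap` asks, besides the period-compatibility clause (★
`Literature.AlgebraicGeometry.ModuliOfAbelianVarieties.hcompat_of_pointwiseHeckeQuotient`, p744448), for `Φ s′ = x` at the linked
point.  This follows from the link's ANALYTIC CUT («every `(Z, r′)`-admissible triple of class `ι′ s′` has a `(θZ, r)`-admissible
partner of class `x`», the last conjunct of ★ `HeckeLinked`), the period compatibility at `s′`, ONE admissible pair of class `ι′ s′`
(supplied by thickness, ★-HOME `IsThickAtWith`), and ★ P6 `classifyingMap_eq_of_isAdmissibleAt` (two triples admissible at the same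
`(θZ, r)` have the same classifying map).

* `heckeQuotient_class_eq` — `Φ s′ = x`.
-/

set_option autoImplicit false

noncomputable section

open CategoryTheory CategoryTheory.Limits AlgebraicGeometry Matrix Topology
open Literature.AlgebraicGeometry.Motives (SchemeOver ComplexPoints AlgPoints specOver AbelianVariety CartierDivisor)
open Literature.AlgebraicGeometry.AbelianSchemes (PolarizedAbelianSchemeWithLevel AbelianSchemeOver)
open Literature.NumberTheory.Automorphic (siegelUpperHalfSpace)
open Literature.AlgebraicGeometry.ModuliOfAbelianVarieties

namespace Summit.HodgeConjecture.CorCM.HypDel.EquidimHeckeQuotient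

open SiegelModuli (jOfSiegel)

/-- **`Φ(s′) = x`**: if every `(Z, r′)`-admissible level-`N′` triple of class `y` has a `(θZ, r)`-admissible level-`N` partner of
class `x` (the link's analytic cut) AND one of class `Φ₀` (the period compatibility of the quotient at `s′`), and SOME
`(Z, r′)`-admissible triple of class `y` exists, then `Φ₀ = x` — both partners are admissible at the same `(θZ, r)`, `r ∈ K_δ(1)`,
so ★ P6 `classifyingMap_eq_of_isAdmissibleAt` identifies their classes. [cite: Milne2005ShimuraVarieties, §6 Thm. 6.11 pp. 74–75] -/
theorem heckeQuotient_class_eq {g N N' : ℕ} {δ : Fin g → ℕ} (hg : 0 < g) (hδ : IsPolarizationType δ) (hN : 3 ≤ N)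
    (𝓜 : SiegelFineModuliScheme g N δ) (𝓜' : SiegelFineModuliScheme g N' δ) [IsLocallyNoetherian (specOver ℚ ℂ).left]
    (r : gspFinAdelic δ) (hr : r ∈ principalLevelSubgroup δ 1) (r' : gspFinAdelic δ)
    (θ : siegelUpperHalfSpace g → siegelUpperHalfSpace g)
    (y : ComplexPoints ((Literature.AlgebraicGeometry.Motives.baseChange ℚ ℂ).obj 𝓜'.M))
    (x Φ₀ : ComplexPoints ((Literature.AlgebraicGeometry.Motives.baseChange ℚ ℂ).obj 𝓜.M))
    (hcut : ∀ (Z : siegelUpperHalfSpace g) (P' : PolarizedAbelianSchemeWithLevel g N' δ (specOver ℚ ℂ).left),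
      IsAdmissibleAt hδ r' Z.1 Z.2 P' →
      AlgPoints.baseChangeEquiv (algebraMap ℚ ℂ) 𝓜'.M (𝓜'.classifyingMap (specOver ℚ ℂ) P') = y →
      ∃ P : PolarizedAbelianSchemeWithLevel g N δ (specOver ℚ ℂ).left,
        IsAdmissibleAt hδ r (θ Z).1 (θ Z).2 P ∧
        AlgPoints.baseChangeEquiv (algebraMap ℚ ℂ) 𝓜.M (𝓜.classifyingMap (specOver ℚ ℂ) P) = x)
    (hcompat : ∀ (Z : siegelUpperHalfSpace g) (P' : PolarizedAbelianSchemeWithLevel g N' δ (specOver ℚ ℂ).left),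
      IsAdmissibleAt hδ r' Z.1 Z.2 P' →
      AlgPoints.baseChangeEquiv (algebraMap ℚ ℂ) 𝓜'.M (𝓜'.classifyingMap (specOver ℚ ℂ) P') = y →
      ∃ P : PolarizedAbelianSchemeWithLevel g N δ (specOver ℚ ℂ).left,
        IsAdmissibleAt hδ r (θ Z).1 (θ Z).2 P ∧
        AlgPoints.baseChangeEquiv (algebraMap ℚ ℂ) 𝓜.M (𝓜.classifyingMap (specOver ℚ ℂ) P) = Φ₀)
    (hex : ∃ (Z : siegelUpperHalfSpace g) (P' : PolarizedAbelianSchemeWithLevel g N' δ (specOver ℚ ℂ).left),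
      IsAdmissibleAt hδ r' Z.1 Z.2 P' ∧
      AlgPoints.baseChangeEquiv (algebraMap ℚ ℂ) 𝓜'.M (𝓜'.classifyingMap (specOver ℚ ℂ) P') = y) :
    Φ₀ = x := by
  obtain ⟨Z, P', hadm, hcls⟩ := hex
  obtain ⟨P, hP, hPx⟩ := hcut Z P' hadm hcls
  obtain ⟨Q, hQ, hQΦ⟩ := hcompat Z P' hadm hcls
  have h := Summit.HodgeConjecture.CorCM.HypDel.UHead.classifyingMap_eq_of_isAdmissibleAt g N δ hg hδ hN 𝓜 r hr
    (θ Z).1 (θ Z).2 P Q hP hQ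
  rw [← hPx, ← hQΦ]
  exact congrArg _ h.symm

end Summit.HodgeConjecture.CorCM.HypDel.EquidimHeckeQuotient

end
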